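import Mathlib
import Literature.NumberTheory.Irrationality.BrownZudilin2022.GeneralFamily
import Literature.NumberTheory.Irrationality.BrownZudilin2022.WellPoisedDual
import Literature.NumberTheory.Irrationality.BrownZudilin2022.CubicalForm
import HarnessLib

/-!
# Brown–Zudilin 2022, Sect. 3 (10)–(11), Sect. 5 (16) and Sect. 7 (27): the cube integral `J(p;q)`, its
Barnes-type double contour integral, and the invariance of (27) under the whole group `G ≅ Σ₇`

Topic `Literature/NumberTheory/Irrationality/BrownZudilin2022` (same namespace as `CellularZetaFive.lean`,
`GeneralFamily.lean`, `WellPoisedDual.lean`). Read on the page from F. Brown, W. Zudilin, *On cellular rational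
approximations to ζ(5)*, arXiv:2210.03391 [BrownZudilin2022] (pages re-read by the filer, lead/lit g16, 2026-08-22: (10)–(11) p. 8, (16) p. 11 with 'where Re α, Re β > 0', (27) p. 19 'is invariant under G', Remark 4 / Sect. 8 'G is naturally isomorphic to Σ₇'). DEFINITIONS with bodies and three NAMED FACTS
(`def … : Prop`, no proofs, used downstream as hypotheses `(h : …)`). Requested by the cell's gen-1 lineage
(memo `pub-zeta5-gen-1/D2-CELLULAR-g20.md`): these are the published inputs of an (H1)-free proof of the
cellular three-term relations of the wedge dictionary. HONEST FRAMING (cell pub-zeta5): systematic search; no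
irrationality claim unless certified — nothing here asserts anything about the arithmetic of ζ(5).

* (10) ITSELF IS ALREADY IN THE TREE — `CubicalForm.lean` (p307607): `openCube`, `integrandJ p q`, `Jintegral p q = J(p;q)`
  [BrownZudilin2022, Sect. 3, (10)], the constraints (11) `JConstraints`, and the NAMED FACTS `cellularIntegral_eq_cubicalIntegral`
  ((1) = (8)) and `cubicalIntegral_eq_Jintegral` ((8) = (10), i.e. `I(a)` in cubical form `= J(p(a);q(a))` for convergent `a`);
  this file REUSES them (filer's rebase, lead/lit g16: the staged draft re-declared `openCube`/`cubeIntegrand`/`Jcube` and a fact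
  `cellular_eq_Jcube`, which is the composition of those two tree facts — dropped here, nothing new is asserted about (10));
* `barnesKernel p q s t`, `Chamber p q c₁ c₂`, `barnesPrefactor p q` and FACT `barnes_double` — (16):
  "J(p;q) = q₁!q₂!q₄!q₅!/(p₀!p₆!(p₃+q₃−p₀−p₆)!) × (1/2πi)∫_{−c₁−i∞}^{−c₁+i∞} ds Γ(p₀+1+s)Γ(p₁+1+s)Γ(p₂+1+s)Γ(−s)
   /(Γ(p₁+q₁+2+s)Γ(p₂+q₂+2+s)) × (1/2πi)∫_{−c₂−i∞}^{−c₂+i∞} dt Γ(p₄+1+t)Γ(p₅+1+t)Γ(p₆+1+t)Γ(−t)/(Γ(p₄+q₄+2+t)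
   Γ(p₅+q₅+2+t)) × Γ(p₃+2+s+t)Γ(q₃−p₀−p₆−1−s−t), where the real numbers c₁, c₂ satisfy 0 < c₁ < 1+min{p₀,p₁,p₂},
   0 < c₂ < 1+min{p₄,p₅,p₆} and c₁+c₂ > 1+p₀+p₆−q₃" [BrownZudilin2022, Sect. 5, (16)]. Sect. 5 derives (15)–(16)
  for the general integral (10) (the constraints (11) are not used). The derivation applies Euler's integral
  `∫₀^∞ z^{α−1}(1+z)^{−α−β}dz = Γ(α)Γ(β)/Γ(α+β)`, "where Re α, Re β > 0", with `α = p₃+2+s+t`,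
  `β = q₃−p₀−p₆−1−s−t` (p. 10): `Re β > 0` on the contours is the printed `c₁+c₂ > 1+p₀+p₆−q₃`, and `Re α > 0` is
  `c₁+c₂ < p₃+2`, which the display leaves implicit; `Chamber` carries BOTH (without the latter the identity fails,
  e.g. at `p = (3,3,3,3,1,2,3), q = (0,2,2,1,1)`, `c₁+c₂ = 5.8`). With `s = −c₁+iy₁`, `t = −c₂+iy₂` the two factors
  `1/(2πi)` and `ds dt = −dy₁dy₂` combine to `1/(4π²) ∫∫_{ℝ²} … dy₁dy₂`, which is how the fact is typed (Bochner
  integral on `ℝ × ℝ`); the integrand decays exponentially on the contours ("a product of a rational function and of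
  reciprocals of sines", Remark 1), and its integrability is recorded as the first conjunct;
* `aOfB`, `slotPerm σ a` and FACT `invariance_group` — (27) for the whole group: "The analysis above implies that
  the quantity I(a)/∏_{i∈F} h_i! (27) is invariant under G" [BrownZudilin2022, Sect. 7, (27)], `G` of order `7!`
  acting on `(b₁,…,b₇)` of Sect. 9–10 by permutations (Remark 4; Sect. 8: "G is naturally isomorphic to Σ₇");
  typed, like `invariance_of_converges'` (the same sentence restricted to the five generators), with BOTH ends
  convergent and the quotient normalisation `normalisedIntegral'`.
-/

noncomputable section

open MeasureTheory Set Finset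

namespace Literature.NumberTheory.Irrationality.BrownZudilin2022

/-! ### (16): the Barnes-type double integral -/

/-- The integrand of (16) at `(s,t) ∈ ℂ²`:
`Γ(p₀+1+s)Γ(p₁+1+s)Γ(p₂+1+s)Γ(−s)/(Γ(p₁+q₁+2+s)Γ(p₂+q₂+2+s)) · Γ(p₄+1+t)Γ(p₅+1+t)Γ(p₆+1+t)Γ(−t)
 /(Γ(p₄+q₄+2+t)Γ(p₅+q₅+2+t)) · Γ(p₃+2+s+t)Γ(q₃−p₀−p₆−1−s−t)`. [cite: BrownZudilin2022, Sect. 5, eq. (16)] -/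
def barnesKernel (p : Fin 7 → ℤ) (q : Fin 5 → ℤ) (s t : ℂ) : ℂ :=
  Complex.Gamma ((p 0 : ℂ) + 1 + s) * Complex.Gamma ((p 1 : ℂ) + 1 + s) * Complex.Gamma ((p 2 : ℂ) + 1 + s) *
        Complex.Gamma (-s) /
      (Complex.Gamma ((p 1 : ℂ) + (q 0 : ℂ) + 2 + s) * Complex.Gamma ((p 2 : ℂ) + (q 1 : ℂ) + 2 + s)) *
    (Complex.Gamma ((p 4 : ℂ) + 1 + t) * Complex.Gamma ((p 5 : ℂ) + 1 + t) * Complex.Gamma ((p 6 : ℂ) + 1 + t) *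
        Complex.Gamma (-t) /
      (Complex.Gamma ((p 4 : ℂ) + (q 3 : ℂ) + 2 + t) * Complex.Gamma ((p 5 : ℂ) + (q 4 : ℂ) + 2 + t))) *
    (Complex.Gamma ((p 3 : ℂ) + 2 + s + t) * Complex.Gamma ((q 2 : ℂ) - (p 0 : ℂ) - (p 6 : ℂ) - 1 - s - t))

/-- The admissible abscissae of (16): `0 < c₁ < 1+min{p₀,p₁,p₂}`, `0 < c₂ < 1+min{p₄,p₅,p₆}`,
`c₁+c₂ > 1+p₀+p₆−q₃` (printed) and `c₁+c₂ < p₃+2` (the condition `Re α > 0`, `α = p₃+2+s+t`, of the Eulerian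
integral used in the derivation on p. 10, implicit in the display). [cite: BrownZudilin2022, Sect. 5, eq. (16)] -/
def Chamber (p : Fin 7 → ℤ) (q : Fin 5 → ℤ) (c₁ c₂ : ℝ) : Prop :=
  0 < c₁ ∧ c₁ < 1 + min (p 0) (min (p 1) (p 2)) ∧ 0 < c₂ ∧ c₂ < 1 + min (p 4) (min (p 5) (p 6)) ∧
    (1 : ℝ) + p 0 + p 6 - q 2 < c₁ + c₂ ∧ c₁ + c₂ < (p 3 : ℝ) + 2

/-- The prefactor of (16): `q₁!q₂!q₄!q₅!/(p₀!p₆!(p₃+q₃−p₀−p₆)!)` (integer arguments through `Int.toNat`; on a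
non-empty `Chamber` all of them are `≥ 0`). [cite: BrownZudilin2022, Sect. 5, eq. (16)] -/
def barnesPrefactor (p : Fin 7 → ℤ) (q : Fin 5 → ℤ) : ℝ :=
  ((q 0).toNat.factorial * (q 1).toNat.factorial * (q 3).toNat.factorial * (q 4).toNat.factorial : ℕ) /
    ((p 0).toNat.factorial * (p 6).toNat.factorial * (p 3 + q 2 - p 0 - p 6).toNat.factorial : ℕ)

/-- **The Barnes-type double integral (16)** (named fact), for the general 12-parameter integral (10) (`Jintegral` of `CubicalForm.lean`) with
non-negative integer parameters and any admissible `(c₁,c₂)`: the kernel is integrable on the pair of vertical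
lines `Re s = −c₁`, `Re t = −c₂` (first conjunct; exponential decay, Remark 1) and
`J(p;q) = q₁!q₂!q₄!q₅!/(p₀!p₆!(p₃+q₃−p₀−p₆)!) · (1/4π²) ∫∫_{ℝ²} kernel(−c₁+iy₁, −c₂+iy₂) dy₁dy₂`
(the two factors `1/(2πi)` against `ds dt = (i dy₁)(i dy₂)`). [cite: BrownZudilin2022, Sect. 5, eq. (16)] -/
def barnes_double : Prop :=
  ∀ (p : Fin 7 → ℤ) (q : Fin 5 → ℤ) (c₁ c₂ : ℝ), (∀ i, 0 ≤ p i) → (∀ j, 0 ≤ q j) → Chamber p q c₁ c₂ →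
    Integrable (fun y : ℝ × ℝ => barnesKernel p q (-(c₁ : ℂ) + (y.1 : ℂ) * Complex.I) (-(c₂ : ℂ) + (y.2 : ℂ) * Complex.I)) ∧
    (Jintegral p q : ℂ) = (barnesPrefactor p q : ℂ) * ((4 : ℂ) * (Real.pi : ℂ) ^ 2)⁻¹ *
        ∫ y : ℝ × ℝ, barnesKernel p q (-(c₁ : ℂ) + (y.1 : ℂ) * Complex.I) (-(c₂ : ℂ) + (y.2 : ℂ) * Complex.I)

/-! ### (27) for the whole group `G ≅ Σ₇` -/

/-- The inverse of `bOfA` (Sect. 9, last display, solved for `a`):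
`a = (b₀−b₁−b₂, b₂, b₀−b₂−b₃, b₃, b₀−b₃−b₄, b₀−b₅−b₆, b₀−b₆−b₇, b₀−b₃−b₅)`; see `aOfB_bOfA`.
[cite: BrownZudilin2022, Sect. 9, last display] -/
def aOfB (b : ℕ → ℤ) : Fin 8 → ℤ :=
  ![b 0 - b 1 - b 2, b 2, b 0 - b 2 - b 3, b 3, b 0 - b 3 - b 4, b 0 - b 5 - b 6, b 0 - b 6 - b 7, b 0 - b 3 - b 5]

/-- `aOfB` inverts `bOfA`. [cite: BrownZudilin2022, Sect. 9, last display] -/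
theorem aOfB_bOfA (a : Fin 8 → ℤ) : aOfB (bOfA a) = a := by
  ext i; fin_cases i <;> simp [aOfB, bOfA] <;> ring

/-- The action of `σ ∈ Σ₇` on the exponents `a` through the dual parameters: `b₀` fixed, `(b₁,…,b₇)` permuted
(`(σ·b)_j = b_{σ⁻¹ j}`), transported back by `aOfB` (Sect. 8: "G is naturally isomorphic to Σ₇"; Sect. 10: the group
permutes the symmetric parameters `s₁,…,s₇`, i.e. `b_j = s₀ − s_j`). [cite: BrownZudilin2022, Sect. 8 and Sect. 10] -/
def slotPerm (σ : Equiv.Perm (Fin 7)) (a : Fin 8 → ℤ) : Fin 8 → ℤ :=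
  aOfB fun j => if h : 1 ≤ j ∧ j ≤ 7 then bOfA a ((σ.symm ⟨j - 1, by omega⟩ : Fin 7) + 1) else bOfA a j

/-- The five generators of Sect. 7 ARE slot permutations: `p₀₁ = (34)`. [cite: BrownZudilin2022, Sect. 7–8] -/
theorem slotPerm_p01 (a : Fin 8 → ℤ) : slotPerm (Equiv.swap (2 : Fin 7) 3) a = genP01 a := by
  ext i; fin_cases i <;> simp [slotPerm, aOfB, bOfA, genP01, Equiv.swap_apply_def] <;> ring

/-- `p₁₂ = (35)`. [cite: BrownZudilin2022, Sect. 7–8] -/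
theorem slotPerm_p12 (a : Fin 8 → ℤ) : slotPerm (Equiv.swap (2 : Fin 7) 4) a = genP12 a := by
  ext i; fin_cases i <;> simp [slotPerm, aOfB, bOfA, genP12, Equiv.swap_apply_def] <;> ring

/-- `h = (36)`. [cite: BrownZudilin2022, Sect. 7–8] -/
theorem slotPerm_h (a : Fin 8 → ℤ) : slotPerm (Equiv.swap (2 : Fin 7) 5) a = genH a := by
  ext i; fin_cases i <;> simp [slotPerm, aOfB, bOfA, genH, Equiv.swap_apply_def] <;> ring

/-- `h' = (46)`. [cite: BrownZudilin2022, Sect. 7–8] -/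
theorem slotPerm_h' (a : Fin 8 → ℤ) : slotPerm (Equiv.swap (3 : Fin 7) 5) a = genH' a := by
  ext i; fin_cases i <;> simp [slotPerm, aOfB, bOfA, genH', Equiv.swap_apply_def] <;> ring

/-- `i₁ = (14)(23)(57)`. [cite: BrownZudilin2022, Sect. 7–8] -/
theorem slotPerm_i1 (a : Fin 8 → ℤ) :
    slotPerm (Equiv.swap (0 : Fin 7) 3 * Equiv.swap (1 : Fin 7) 2 * Equiv.swap (4 : Fin 7) 6) a = genI1 a := by
  ext i; fin_cases i <;>
    simp [slotPerm, aOfB, bOfA, genI1, Equiv.Perm.mul_def, Equiv.symm_swap,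
      Equiv.swap_apply_def] <;> ring

/-- **Invariance of (27) under the group `G`** (named fact; the printed sentence "The analysis above implies that
the quantity I(a)/∏_{i∈F} h_i! (27) is invariant under G", `|G| = 7!`, `G ≅ Σ₇` acting by permutations of
`b₁,…,b₇`), typed like `invariance_of_converges'`: quotient normalisation, and both `a` and `σ·a` convergent so
that both Bochner integrals are the printed ones. `invariance_of_converges'` is the special case of the five
generators `i₁ = (14)(23)(57)`, `p₀₁ = (34)`, `p₁₂ = (35)`, `h = (36)`, `h' = (46)`.
[cite: BrownZudilin2022, Sect. 7, eq. (27); Sect. 8, Remark 4] -/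
def invariance_group : Prop :=
  ∀ (σ : Equiv.Perm (Fin 7)) (a : Fin 8 → ℤ), Converges a → Converges (slotPerm σ a) →
    normalisedIntegral' (slotPerm σ a) = normalisedIntegral' a



end Literature.NumberTheory.Irrationality.BrownZudilin2022
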